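import Mathlib
import HarnessLib
import Literature.Probability.MarkovChains.OptimalCoupling
import Literature.Probability.MarkovChains.BottleneckRatio

/-!
# The transportation metric and path coupling: `ρ_K(μP, νP) ≤ e^{−α} ρ_K(μ, ν)` from edge contraction (Levin–Peres–Wilmer Ch. 14, Bubley–Dyer 1997)

HONEST FRAMING: exact (Metropolis-corrected) sampling algorithms for lattice gauge theory; figures
of merit are autocorrelation/cost numbers at stated couplings and volumes; no continuum-physics claim.

Conventions of `TotalVariation.lean` (`tvDist`, `stepLaw P μ = μP`, `lawAt P μ t = μPᵗ`,
`IsRowStochastic`), `MetropolisHastings.lean` (`IsStationary π P`), `ContractionSpectralGap.lean`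
(`IsCoupling μ ν q`: a coupling given by a joint law `q` on `X × X` with marginals `μ`, `ν`),
`OptimalCoupling.lean` (Prop. 4.7) and `BottleneckRatio.lean` (`worstTvDist P π t = d(t)`,
`mixingTime P π ε = t_mix(ε)`).  Source: D. A. Levin, Y. Peres (with E. L. Wilmer), *Markov Chains
and Mixing Times*, 2nd ed., AMS 2017 [LevinPeres2017], Chapter 14 "The Transportation Metric and
Path Coupling", §14.1–§14.2, pp. 201–205 (read on the author-hosted copy of the 2nd edition).
Everything is PROVED (finite sums and one compactness argument; 0 named facts).

* `transportCost ρ q = Σ_{x,y} ρ(x,y) q(x,y)` (= `E ρ(X,Y)` for `(X,Y) ∼ q`) and **(14.2)–(14.3)**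
  `transportDist ρ μ ν = ρ_K(μ,ν) = inf {Σ ρ q : q a coupling of μ and ν}`
  [cite: LevinPeres2017, §14.1 eqs. (14.2)–(14.3)];
* **REMARK 14.2** `LevinPeres2017_rem_14_2` — the couplings of `μ` and `ν` form a compact set on
  which `q ↦ Σ ρ q` is continuous, so a **`ρ`-optimal coupling** `q⋆` with `Σ ρ q⋆ = ρ_K(μ,ν)`
  exists (`isCompact_couplings`, `continuous_transportCost`) [cite: LevinPeres2017, §14.1 Remark 14.2];
* **LEMMA 14.3** `LevinPeres2017_lemma_14_3` — `ρ_K` satisfies the triangle inequality, via the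
  gluing **(14.4)** `r(x,y,z) = p(x,y)q(y,z)/ν(y)` (`glueCoupling`, `glueCoupling_isCoupling`,
  `transportCost_glueCoupling_le`); with `transportDist_comm`, `transportDist_self` ("the other
  two conditions"), `transportDist_single_single` (`ρ_K(δ_x,δ_y) = ρ(x,y)`) and
  `eq_of_transportDist_eq_zero` [cite: LevinPeres2017, §14.1 Lemma 14.3, eq. (14.4), and the
  paragraph after its proof];
* `transportDist_indicator_eq_tvDist` — for `ρ = 1{x ≠ y}`, `ρ_K = ‖μ − ν‖_TV` (Prop. 4.7)
  [cite: LevinPeres2017, §14.1 (sentence after (14.2))]; **(14.6)–(14.7)**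
  `IsCoupling.offDiag_le_transportCost` (`P{X ≠ Y} ≤ E ρ(X,Y)` when `ρ(x,y) ≥ 1{x ≠ y}`) and
  `LevinPeres2017_eq_14_7` (**`‖μ − ν‖_TV ≤ ρ_K(μ,ν)`**) [cite: LevinPeres2017, §14.2 eqs. (14.6)–(14.7)];
* `mixCoupling η θ = Σ_{x,y} η(x,y) θ_{x,y}` — the coupling of `μP` with `νP` built from a coupling
  `η` of `μ, ν` and couplings `θ_{x,y}` of `P(x,·), P(y,·)` (`mixCoupling_isCoupling`,
  `transportCost_mixCoupling`), and `transportDist_stepLaw_le_of_forall`: if EVERY pair `x, y`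
  admits a coupling with `E ρ(X₁,Y₁) ≤ e^{−α}ρ(x,y)` (the all-pairs contraction **(14.1)**) then
  `ρ_K(μP,νP) ≤ e^{−α}ρ_K(μ,ν)` [cite: LevinPeres2017, §14.2 proof of Thm 14.6 (last paragraph,
  p. 205: "`θ := Σ η(x,y)θ_{x,y}` … is a coupling of `μP` with `νP`") and Ch. 14 opening display (14.1)];
* **THEOREM 14.6 (Bubley–Dyer 1997)** `LevinPeres2017_thm_14_6` — if `ρ ≥ 0` vanishes on the
  diagonal and satisfies the triangle inequality, every pair is joined by a path of EDGES
  (`IsGraphPath`) of `ρ`-length `≤ ρ(x,y)` (for the path metric (14.5) of a connected graph: a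
  minimising path), and for each EDGE `{x,y}` there is a
  coupling of `P(x,·), P(y,·)` with `E ρ(X₁,Y₁) ≤ e^{−α}ρ(x,y)` **(14.8)**, then **(14.12)**
  `ρ_K(P(x,·),P(y,·)) ≤ e^{−α}ρ(x,y)` for ALL pairs (`LevinPeres2017_eq_14_12`) and **(14.9)**
  **`ρ_K(μP,νP) ≤ e^{−α}ρ_K(μ,ν)`** for all probability vectors `μ, ν`
  [cite: LevinPeres2017, §14.2 Thm 14.6, eqs. (14.8)–(14.9), (14.12)–(14.16)];
* **REMARK 14.7** `LevinPeres2017_rem_14_7` — (14.9) forces the stationary distribution to be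
  unique [cite: LevinPeres2017, §14.2 Remark 14.7]; **COROLLARY 14.8** `LevinPeres2017_cor_14_8`
  (**`d(t) ≤ e^{−αt} diam(X)`**, via **(14.10)–(14.11)**) and `LevinPeres2017_cor_14_8_mixingTime`
  (**`t_mix(ε) ≤ ⌈(−log ε + log diam(X))/α⌉`**) [cite: LevinPeres2017, §14.2 Cor. 14.8,
  eqs. (14.10)–(14.11)]; the same two bounds from the all-pairs contraction (14.1) directly:
  `worstTvDist_le_of_contraction`, `mixingTime_le_of_contraction` [cite: LevinPeres2017, Ch. 14
  opening paragraph (the displays following (14.1))].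

SCOPE / `TODO(general form)`: the graph-with-length-function setting of §14.2 enters only through
the properties of the path metric the printed proof uses — `ρ ≥ 0`, `ρ(x,x) = 0`, the triangle
inequality and, for every pair, an edge path of total length `ρ(x,y)` ((14.5) attained, (14.13));
they are taken as hypotheses (`hρ`, `hρ0`, `hρt`, `hpath`) rather than derived from a `SimpleGraph`
with edge lengths `ℓ ≥ 1` (for which they hold, together with `ρ(x,y) ≥ 1{x ≠ y}`).  `rhoDiam ρ` is
`diam(X) = max ρ`.  Context (cell pub-lqcd,
venture LatticeQCDFlow): path coupling is the standard route to `O(n log n)` mixing bounds for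
single-site heat-bath / Glauber updates under a Dobrushin-type condition (LPW Thm 15.1 uses exactly
Thm 14.6); it is recorded here as the published tool, with the cell's figure of merit `d(t)` /
`t_mix` as its output.
-/

namespace Literature.Probability.MarkovChains

open Finset

variable {X : Type*} [Fintype X] [DecidableEq X]

/-! ## The transportation metric (14.2)–(14.3) -/

section TransportCost

omit [DecidableEq X]

/-- `E ρ(X,Y) = Σ_{x,y} ρ(x,y) q(x,y)` when `(X,Y)` has joint law `q`.
[cite: LevinPeres2017, §14.1 (display before (14.3))] -/
def transportCost (ρ : X → X → ℝ) (q : X → X → ℝ) : ℝ := ∑ a, ∑ b, ρ a b * q a b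

/-- The set of couplings of `μ` and `ν` given by joint laws on `X × X` (Remark 14.1).
[cite: LevinPeres2017, §14.1 Remark 14.1] -/
def couplings (μ ν : X → ℝ) : Set (X → X → ℝ) := {q | IsCoupling μ ν q}

/-- Membership in `couplings μ ν` is `IsCoupling μ ν`. [cite: LevinPeres2017, §14.1 Remark 14.1 (the projections `q(·×X) = μ`, `q(X×·) = ν` of a distribution `q` on `X × X`)] -/
theorem mem_couplings {μ ν : X → ℝ} {q : X → X → ℝ} :
    q ∈ couplings μ ν ↔ IsCoupling μ ν q := Iff.rfl

/-- **(14.2)–(14.3)** the transportation metric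
`ρ_K(μ,ν) = inf {Σ_{x,y} ρ(x,y) q(x,y) : q(·×X) = μ, q(X×·) = ν}` (junk value `0` when `μ`, `ν` admit
no coupling, by `Real.sInf_empty`). [cite: LevinPeres2017, §14.1 eqs. (14.2)–(14.3)] -/
noncomputable def transportDist (ρ : X → X → ℝ) (μ ν : X → ℝ) : ℝ :=
  sInf (transportCost ρ '' couplings μ ν)

/-- `Σ ρ q ≥ 0` for `ρ, q ≥ 0`. [cite: LevinPeres2017, §14.1 eq. (14.3) (the objective
`Σ ρ(x,y)q(x,y)`)] -/
theorem transportCost_nonneg {ρ q : X → X → ℝ} (hρ : ∀ a b, 0 ≤ ρ a b) (hq : ∀ a b, 0 ≤ q a b) :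
    0 ≤ transportCost ρ q :=
  sum_nonneg fun a _ => sum_nonneg fun b _ => mul_nonneg (hρ a b) (hq a b)

/-- `Σ ρ q ≤ D · Σ q` when `ρ ≤ D` and `q ≥ 0`. [cite: LevinPeres2017, §14.2 eq. (14.10) (second
inequality: the expected distance is at most `max_{x,y} ρ(x,y)`)] -/
theorem transportCost_le_mul_sum {ρ q : X → X → ℝ} {D : ℝ} (hD : ∀ a b, ρ a b ≤ D)
    (hq : ∀ a b, 0 ≤ q a b) : transportCost ρ q ≤ D * ∑ a, ∑ b, q a b := by
  unfold transportCost
  rw [mul_sum]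
  refine sum_le_sum fun a _ => ?_
  rw [mul_sum]
  exact sum_le_sum fun b _ => mul_le_mul_of_nonneg_right (hD a b) (hq a b)

/-- The total mass of a coupling is the mass of its first marginal. [cite: LevinPeres2017, §14.1 Remark 14.1 (the projections `q(·×X) = μ`, `q(X×·) = ν` of a distribution `q` on `X × X`)] -/
theorem IsCoupling.sum_sum_eq {μ ν : X → ℝ} {q : X → X → ℝ} (hq : IsCoupling μ ν q) :
    ∑ a, ∑ b, q a b = ∑ a, μ a :=
  sum_congr rfl fun a _ => hq.2.1 a

/-- An entry of a coupling is bounded by the marginal: `q(a,b) ≤ μ(a)` (Remark 14.2: the couplings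
lie in the simplex). [cite: LevinPeres2017, §14.1 Remark 14.1 (the projections `q(·×X) = μ`, `q(X×·) = ν` of a distribution `q` on `X × X`)] -/
theorem IsCoupling.apply_le_left {μ ν : X → ℝ} {q : X → X → ℝ} (hq : IsCoupling μ ν q) (a b : X) :
    q a b ≤ μ a := by
  rw [← hq.2.1 a]
  exact single_le_sum (f := fun b => q a b) (fun b _ => hq.1 a b) (mem_univ b)

/-- `q(a,b) ≤ ν(b)`. [cite: LevinPeres2017, §14.1 Remark 14.1 (the projections `q(·×X) = μ`, `q(X×·) = ν` of a distribution `q` on `X × X`)] -/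
theorem IsCoupling.apply_le_right {μ ν : X → ℝ} {q : X → X → ℝ} (hq : IsCoupling μ ν q) (a b : X) :
    q a b ≤ ν b := by
  rw [← hq.2.2 b]
  exact single_le_sum (f := fun a => q a b) (fun a _ => hq.1 a b) (mem_univ a)

/-- The marginals of a coupling are non-negative. [cite: LevinPeres2017, §14.1 Remark 14.1 (the projections `q(·×X) = μ`, `q(X×·) = ν` of a distribution `q` on `X × X`)] -/
theorem IsCoupling.left_nonneg {μ ν : X → ℝ} {q : X → X → ℝ} (hq : IsCoupling μ ν q) (a : X) :
    0 ≤ μ a := by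
  rw [← hq.2.1 a]; exact sum_nonneg fun b _ => hq.1 a b

/-- The second marginal of a coupling is non-negative. [cite: LevinPeres2017, §14.1 Remark 14.1 (the projections `q(·×X) = μ`, `q(X×·) = ν` of a distribution `q` on `X × X`)] -/
theorem IsCoupling.right_nonneg {μ ν : X → ℝ} {q : X → X → ℝ} (hq : IsCoupling μ ν q) (b : X) :
    0 ≤ ν b := by
  rw [← hq.2.2 b]; exact sum_nonneg fun a _ => hq.1 a b

/-- If the second marginal vanishes at `b`, so does the whole column: `ν(b) = 0 ⇒ q(a,b) = 0`
(used for the convention `0/0 = 0` in the gluing (14.4)). [cite: LevinPeres2017, §14.1 Remark 14.1 (the projections `q(·×X) = μ`, `q(X×·) = ν` of a distribution `q` on `X × X`)] -/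
theorem IsCoupling.apply_eq_zero_of_right {μ ν : X → ℝ} {q : X → X → ℝ} (hq : IsCoupling μ ν q)
    {b : X} (hb : ν b = 0) (a : X) : q a b = 0 :=
  le_antisymm (hb ▸ hq.apply_le_right a b) (hq.1 a b)

/-- `μ(a) = 0 ⇒ q(a,b) = 0`. [cite: LevinPeres2017, §14.1 Remark 14.1 (the projections `q(·×X) = μ`, `q(X×·) = ν` of a distribution `q` on `X × X`)] -/
theorem IsCoupling.apply_eq_zero_of_left {μ ν : X → ℝ} {q : X → X → ℝ} (hq : IsCoupling μ ν q)
    {a : X} (ha : μ a = 0) (b : X) : q a b = 0 :=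
  le_antisymm (ha ▸ hq.apply_le_left a b) (hq.1 a b)

/-- The transpose of a coupling of `μ, ν` is a coupling of `ν, μ` (swap the two projections). [cite: LevinPeres2017, §14.1 Remark 14.1 (the projections `q(·×X) = μ`, `q(X×·) = ν` of a distribution `q` on `X × X`)] -/
theorem IsCoupling.transpose {μ ν : X → ℝ} {q : X → X → ℝ} (hq : IsCoupling μ ν q) :
    IsCoupling ν μ (fun a b => q b a) :=
  ⟨fun a b => hq.1 b a, hq.2.2, hq.2.1⟩

/-- For a coupling of two probability vectors, `Σ ρ q ≤ D` whenever `ρ ≤ D`: the expected distance is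
at most the diameter. [cite: LevinPeres2017, §14.2 eq. (14.10) (second inequality,
`ρ_K(μ,ν) ≤ max_{x,y} ρ(x,y)`)] -/
theorem IsCoupling.transportCost_le {μ ν : X → ℝ} {q : X → X → ℝ} (hq : IsCoupling μ ν q)
    (hμ1 : ∑ a, μ a = 1) {ρ : X → X → ℝ} {D : ℝ} (hD : ∀ a b, ρ a b ≤ D) : transportCost ρ q ≤ D := by
  have h := transportCost_le_mul_sum hD hq.1 (ρ := ρ)
  rwa [hq.sum_sum_eq, hμ1, mul_one] at h

/-- **(14.6)** `P{X ≠ Y} = E 1{X ≠ Y} ≤ E ρ(X,Y)` when `ρ ≥ 0` and `ρ(x,y) ≥ 1` for `x ≠ y`.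
[cite: LevinPeres2017, §14.2 eq. (14.6)] -/
theorem IsCoupling.offDiag_le_transportCost [DecidableEq X] {μ ν : X → ℝ} {q : X → X → ℝ}
    (hq : IsCoupling μ ν q) {ρ : X → X → ℝ} (hρ : ∀ a b, 0 ≤ ρ a b) (hρ1 : ∀ a b, a ≠ b → 1 ≤ ρ a b) :
    ∑ a, ∑ b ∈ univ.erase a, q a b ≤ transportCost ρ q := by
  unfold transportCost
  refine sum_le_sum fun a _ => ?_
  calc ∑ b ∈ univ.erase a, q a b ≤ ∑ b ∈ univ.erase a, ρ a b * q a b :=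
        sum_le_sum fun b hb => le_mul_of_one_le_left (hq.1 a b) (hρ1 a b (ne_of_mem_erase hb).symm)
    _ ≤ ∑ b, ρ a b * q a b :=
        sum_le_sum_of_subset_of_nonneg (erase_subset _ _) fun b _ _ => mul_nonneg (hρ a b) (hq.1 a b)

end TransportCost

/-! ## Remark 14.2: compactness of the set of couplings and `ρ`-optimal couplings -/

section Optimal

omit [DecidableEq X]

/-- Two probability vectors always admit a coupling (the independent one).
[cite: LevinPeres2017, §4.2 Example 4.6 (i)] -/
theorem couplings_nonempty {μ ν : X → ℝ} (hμ : ∀ a, 0 ≤ μ a) (hν : ∀ b, 0 ≤ ν b)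
    (hμ1 : ∑ a, μ a = 1) (hν1 : ∑ b, ν b = 1) : (couplings μ ν).Nonempty :=
  ⟨fun a b => μ a * ν b, isCoupling_mul hμ hν hμ1 hν1⟩

/-- The couplings of `μ` and `ν` lie in the box `0 ≤ q(a,b) ≤ μ(a)`. [cite: LevinPeres2017, §14.1
Remark 14.2 (a subset of the simplex)] -/
theorem couplings_subset_Icc (μ ν : X → ℝ) :
    couplings μ ν ⊆ Set.Icc (0 : X → X → ℝ) (fun a _ => μ a) := fun _ hq =>
  ⟨fun a b => hq.1 a b, fun a b => IsCoupling.apply_le_left hq a b⟩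

/-- The set of couplings is closed ("a closed subset of this simplex"). [cite: LevinPeres2017, §14.1
Remark 14.2] -/
theorem isClosed_couplings (μ ν : X → ℝ) : IsClosed (couplings μ ν) := by
  have hab : ∀ a b : X, Continuous fun q : X → X → ℝ => q a b := fun a b =>
    (continuous_apply b).comp (continuous_apply a)
  have e : couplings μ ν = (⋂ a, ⋂ b, {q : X → X → ℝ | 0 ≤ q a b}) ∩
      ((⋂ a, {q : X → X → ℝ | ∑ b, q a b = μ a}) ∩ ⋂ b, {q : X → X → ℝ | ∑ a, q a b = ν b}) := by
    ext q
    simp only [couplings, IsCoupling, Set.mem_setOf_eq, Set.mem_inter_iff, Set.mem_iInter]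
  rw [e]
  refine (isClosed_iInter fun a => isClosed_iInter fun b => isClosed_le continuous_const (hab a b)).inter
    ((isClosed_iInter fun a => isClosed_eq (continuous_finsetSum _ fun b _ => hab a b)
      continuous_const).inter
    (isClosed_iInter fun b => isClosed_eq (continuous_finsetSum _ fun a _ => hab a b)
      continuous_const))

/-- **Remark 14.2 (compactness)**: the set of couplings of `μ` and `ν` is compact.
[cite: LevinPeres2017, §14.1 Remark 14.2] -/
theorem isCompact_couplings (μ ν : X → ℝ) : IsCompact (couplings μ ν) :=
  (isCompact_Icc : IsCompact (Set.Icc (0 : X → X → ℝ) (fun a _ => μ a))).of_isClosed_subset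
    (isClosed_couplings μ ν) (couplings_subset_Icc μ ν)

/-- **Remark 14.2 (continuity)**: `q ↦ Σ_{x,y} ρ(x,y)q(x,y)` is continuous.
[cite: LevinPeres2017, §14.1 Remark 14.2] -/
theorem continuous_transportCost (ρ : X → X → ℝ) : Continuous (transportCost ρ) :=
  continuous_finsetSum _ fun a _ => continuous_finsetSum _ fun b _ =>
    continuous_const.mul ((continuous_apply b).comp (continuous_apply a))

/-- **REMARK 14.2**: whenever `μ` and `ν` admit a coupling, "there is a `q⋆` such that
`Σ ρ(x,y)q⋆(x,y) = ρ_K(μ,ν)`" — a **`ρ`-optimal coupling** — and it minimises `Σ ρ q` over all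
couplings. [cite: LevinPeres2017, §14.1 Remark 14.2] -/
theorem LevinPeres2017_rem_14_2 (ρ : X → X → ℝ) {μ ν : X → ℝ} (hne : (couplings μ ν).Nonempty) :
    ∃ q, IsCoupling μ ν q ∧ transportCost ρ q = transportDist ρ μ ν ∧
      ∀ q', IsCoupling μ ν q' → transportCost ρ q ≤ transportCost ρ q' := by
  obtain ⟨q, hq, hmin⟩ :=
    (isCompact_couplings μ ν).exists_isMinOn hne (continuous_transportCost ρ).continuousOn
  have hmin' : ∀ q', IsCoupling μ ν q' → transportCost ρ q ≤ transportCost ρ q' :=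
    fun q' hq' => hmin hq'
  refine ⟨q, hq, ?_, hmin'⟩
  refine ((show IsLeast (transportCost ρ '' couplings μ ν) (transportCost ρ q) from
    ⟨⟨q, hq, rfl⟩, ?_⟩).csInf_eq).symm
  rintro _ ⟨q', hq', rfl⟩
  exact hmin' q' hq'

/-- A `ρ`-optimal coupling of two probability vectors exists. [cite: LevinPeres2017, §14.1
Remark 14.2] -/
theorem exists_optimalCoupling (ρ : X → X → ℝ) {μ ν : X → ℝ} (hμ : ∀ a, 0 ≤ μ a)
    (hν : ∀ b, 0 ≤ ν b) (hμ1 : ∑ a, μ a = 1) (hν1 : ∑ b, ν b = 1) :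
    ∃ q, IsCoupling μ ν q ∧ transportCost ρ q = transportDist ρ μ ν :=
  let ⟨q, hq, h, _⟩ := LevinPeres2017_rem_14_2 ρ (couplings_nonempty hμ hν hμ1 hν1)
  ⟨q, hq, h⟩

/-- `ρ_K(μ,ν) ≤ Σ ρ q` for every coupling `q` ("`ρ_K` is a minimum over all couplings").
[cite: LevinPeres2017, §14.1 eq. (14.3); §14.2 proof of Thm 14.6 (sentence before (14.14))] -/
theorem transportDist_le {ρ : X → X → ℝ} {μ ν : X → ℝ} {q : X → X → ℝ} (hq : IsCoupling μ ν q) :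
    transportDist ρ μ ν ≤ transportCost ρ q := by
  obtain ⟨q₀, _, h0, hmin⟩ := LevinPeres2017_rem_14_2 ρ (⟨q, hq⟩ : (couplings μ ν).Nonempty)
  rw [← h0]; exact hmin q hq

/-- A lower bound valid for every coupling is a lower bound for `ρ_K` (when couplings exist).
[cite: LevinPeres2017, §14.1 eq. (14.3)] -/
theorem le_transportDist {ρ : X → X → ℝ} {μ ν : X → ℝ} (hne : (couplings μ ν).Nonempty) {c : ℝ}
    (h : ∀ q, IsCoupling μ ν q → c ≤ transportCost ρ q) : c ≤ transportDist ρ μ ν := by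
  obtain ⟨q₀, hq₀, h0, _⟩ := LevinPeres2017_rem_14_2 ρ hne
  rw [← h0]; exact h q₀ hq₀

/-- `ρ_K ≥ 0` for `ρ ≥ 0`. [cite: LevinPeres2017, §14.1 eq. (14.2)] -/
theorem transportDist_nonneg {ρ : X → X → ℝ} (hρ : ∀ a b, 0 ≤ ρ a b) (μ ν : X → ℝ) :
    0 ≤ transportDist ρ μ ν := by
  refine Real.sInf_nonneg ?_
  rintro _ ⟨q, hq, rfl⟩
  exact transportCost_nonneg hρ hq.1

/-- `ρ_K(μ,ν) ≤ max ρ` for probability vectors (a coupling exists and its expected distance is at most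
the diameter). [cite: LevinPeres2017, §14.2 eq. (14.10) (second inequality)] -/
theorem transportDist_le_of_le {ρ : X → X → ℝ} {μ ν : X → ℝ} (hμ : ∀ a, 0 ≤ μ a) (hν : ∀ b, 0 ≤ ν b)
    (hμ1 : ∑ a, μ a = 1) (hν1 : ∑ b, ν b = 1) {D : ℝ} (hD : ∀ a b, ρ a b ≤ D) :
    transportDist ρ μ ν ≤ D :=
  (transportDist_le (isCoupling_mul hμ hν hμ1 hν1)).trans
    ((isCoupling_mul hμ hν hμ1 hν1).transportCost_le hμ1 hD)

end Optimal

/-! ## Lemma 14.3: `ρ_K` is a metric — the gluing (14.4) -/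

section Metric

omit [DecidableEq X]

/-- **(14.4)** projected to the first and last coordinates: the GLUING of a coupling `p` of `μ, ν`
with a coupling `q` of `ν, η` along `ν`, `r(x,z) = Σ_y p(x,y)q(y,z)/ν(y)` (with `0/0 = 0`: a column
of `p` over a point with `ν(y) = 0` vanishes). [cite: LevinPeres2017, §14.1 eq. (14.4) and
Remark 14.4] -/
noncomputable def glueCoupling (p q : X → X → ℝ) (ν : X → ℝ) : X → X → ℝ :=
  fun x z => ∑ y, p x y * q y z / ν y

/-- `p(x,y) · ν(y)/ν(y) = p(x,y)` for a coupling `p` with second marginal `ν` (both sides vanish when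
`ν(y) = 0`). [folklore] -/
private theorem IsCoupling.mul_div_cancel_right {μ ν : X → ℝ} {p : X → X → ℝ} (hp : IsCoupling μ ν p)
    (x y : X) : p x y * ν y / ν y = p x y := by
  by_cases hy : ν y = 0
  · rw [hy, div_zero, hp.apply_eq_zero_of_right hy]
  · rw [mul_div_assoc, div_self hy, mul_one]

/-- `ν(y) · q(y,z)/ν(y) = q(y,z)` for a coupling `q` with first marginal `ν`. [folklore] -/
private theorem IsCoupling.mul_div_cancel_left {ν η : X → ℝ} {q : X → X → ℝ} (hq : IsCoupling ν η q)
    (y z : X) : ν y * q y z / ν y = q y z := by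
  by_cases hy : ν y = 0
  · rw [hy, div_zero, hq.apply_eq_zero_of_left hy]
  · rw [mul_comm, mul_div_assoc, div_self hy, mul_one]

/-- "The projection of `r` onto the first and last coordinates is a coupling of `μ` and `η`."
[cite: LevinPeres2017, §14.1 proof of Lemma 14.3 (sentence after (14.4))] -/
theorem glueCoupling_isCoupling {μ ν η : X → ℝ} {p q : X → X → ℝ} (hp : IsCoupling μ ν p)
    (hq : IsCoupling ν η q) : IsCoupling μ η (glueCoupling p q ν) := by
  refine ⟨fun x z => sum_nonneg fun y _ =>
    div_nonneg (mul_nonneg (hp.1 x y) (hq.1 y z)) (hp.right_nonneg y), fun x => ?_, fun z => ?_⟩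
  · unfold glueCoupling
    rw [sum_comm]
    calc ∑ y, ∑ z, p x y * q y z / ν y = ∑ y, p x y * ν y / ν y := by
          refine sum_congr rfl fun y _ => ?_
          rw [← hq.2.1 y, mul_sum, sum_div]
      _ = ∑ y, p x y := sum_congr rfl fun y _ => hp.mul_div_cancel_right x y
      _ = μ x := hp.2.1 x
  · unfold glueCoupling
    calc ∑ x, ∑ y, p x y * q y z / ν y = ∑ y, ∑ x, p x y * q y z / ν y := sum_comm
      _ = ∑ y, ν y * q y z / ν y := by
          refine sum_congr rfl fun y _ => ?_
          rw [← hp.2.2 y, sum_mul, sum_div]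
      _ = ∑ y, q y z := sum_congr rfl fun y _ => hq.mul_div_cancel_left y z
      _ = η z := hq.2.2 z

/-- "Since `ρ` is a metric, `ρ(X,Z) ≤ ρ(X,Y) + ρ(Y,Z)`. Taking expectation …": under the triangle
inequality for `ρ`, `E_r ρ(X,Z) ≤ E_p ρ(X,Y) + E_q ρ(Y,Z)`. [cite: LevinPeres2017, §14.1 proof of
Lemma 14.3 (the two displays after (14.4))] -/
theorem transportCost_glueCoupling_le {ρ : X → X → ℝ} (hρt : ∀ x y z, ρ x z ≤ ρ x y + ρ y z)
    {μ ν η : X → ℝ} {p q : X → X → ℝ} (hp : IsCoupling μ ν p) (hq : IsCoupling ν η q) :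
    transportCost ρ (glueCoupling p q ν) ≤ transportCost ρ p + transportCost ρ q := by
  have hw : ∀ x y z, 0 ≤ p x y * q y z / ν y := fun x y z =>
    div_nonneg (mul_nonneg (hp.1 x y) (hq.1 y z)) (hp.right_nonneg y)
  -- `E ρ(X,Z)` as a triple sum, bounded termwise by the triangle inequality
  have h1 : transportCost ρ (glueCoupling p q ν) ≤
      ∑ x, ∑ z, ∑ y, (ρ x y + ρ y z) * (p x y * q y z / ν y) := by
    unfold transportCost glueCoupling
    refine sum_le_sum fun x _ => sum_le_sum fun z _ => ?_
    rw [mul_sum]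
    exact sum_le_sum fun y _ => mul_le_mul_of_nonneg_right (hρt x y z) (hw x y z)
  -- the two pieces are `E ρ(X,Y)` and `E ρ(Y,Z)` (integrate out the third variable)
  have h2 : ∑ x, ∑ z, ∑ y, ρ x y * (p x y * q y z / ν y) = transportCost ρ p := by
    unfold transportCost
    refine sum_congr rfl fun x _ => ?_
    rw [sum_comm]
    refine sum_congr rfl fun y _ => ?_
    rw [← mul_sum, ← sum_div, ← mul_sum, hq.2.1 y, hp.mul_div_cancel_right x y]
  have h3 : ∑ x, ∑ z, ∑ y, ρ y z * (p x y * q y z / ν y) = transportCost ρ q := by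
    unfold transportCost
    rw [sum_comm]
    calc ∑ z, ∑ x, ∑ y, ρ y z * (p x y * q y z / ν y)
        = ∑ z, ∑ y, ρ y z * (ν y * q y z / ν y) := by
          refine sum_congr rfl fun z _ => ?_
          rw [sum_comm]
          refine sum_congr rfl fun y _ => ?_
          rw [← mul_sum, ← hp.2.2 y, sum_mul, sum_div]
      _ = ∑ z, ∑ y, ρ y z * q y z :=
          sum_congr rfl fun z _ => sum_congr rfl fun y _ => by rw [hq.mul_div_cancel_left y z]
      _ = ∑ y, ∑ z, ρ y z * q y z := sum_comm
  calc transportCost ρ (glueCoupling p q ν)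
      ≤ ∑ x, ∑ z, ∑ y, (ρ x y + ρ y z) * (p x y * q y z / ν y) := h1
    _ = ∑ x, ∑ z, ∑ y, ρ x y * (p x y * q y z / ν y) +
        ∑ x, ∑ z, ∑ y, ρ y z * (p x y * q y z / ν y) := by
        simp_rw [add_mul, sum_add_distrib]
    _ = transportCost ρ p + transportCost ρ q := by rw [h2, h3]

/-- **LEMMA 14.3 (triangle inequality)**: for a `ρ` satisfying the triangle inequality and laws
`μ, ν, η` such that `μ, ν` and `ν, η` admit couplings, **`ρ_K(μ,η) ≤ ρ_K(μ,ν) + ρ_K(ν,η)`**.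
[cite: LevinPeres2017, §14.1 Lemma 14.3] -/
theorem LevinPeres2017_lemma_14_3 {ρ : X → X → ℝ} (hρt : ∀ x y z, ρ x z ≤ ρ x y + ρ y z)
    {μ ν η : X → ℝ} (h₁ : (couplings μ ν).Nonempty) (h₂ : (couplings ν η).Nonempty) :
    transportDist ρ μ η ≤ transportDist ρ μ ν + transportDist ρ ν η := by
  obtain ⟨p, hp, hpe, -⟩ := LevinPeres2017_rem_14_2 ρ h₁
  obtain ⟨q, hq, hqe, -⟩ := LevinPeres2017_rem_14_2 ρ h₂
  rw [← hpe, ← hqe]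
  exact (transportDist_le (glueCoupling_isCoupling hp hq)).trans (transportCost_glueCoupling_le hρt hp hq)

/-- Lemma 14.3 for probability vectors. [cite: LevinPeres2017, §14.1 Lemma 14.3] -/
theorem transportDist_triangle {ρ : X → X → ℝ} (hρt : ∀ x y z, ρ x z ≤ ρ x y + ρ y z)
    {μ ν η : X → ℝ} (hμ : ∀ a, 0 ≤ μ a) (hν : ∀ a, 0 ≤ ν a) (hη : ∀ a, 0 ≤ η a)
    (hμ1 : ∑ a, μ a = 1) (hν1 : ∑ a, ν a = 1) (hη1 : ∑ a, η a = 1) :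
    transportDist ρ μ η ≤ transportDist ρ μ ν + transportDist ρ ν η :=
  LevinPeres2017_lemma_14_3 hρt (couplings_nonempty hμ hν hμ1 hν1) (couplings_nonempty hν hη hν1 hη1)

/-- Symmetry of `ρ_K` for a symmetric `ρ` (transpose the coupling). [cite: LevinPeres2017, §14.1
Lemma 14.3 ("the other two conditions")] -/
theorem transportDist_comm {ρ : X → X → ℝ} (hρs : ∀ x y, ρ x y = ρ y x) (μ ν : X → ℝ) :
    transportDist ρ μ ν = transportDist ρ ν μ := by
  have hc : ∀ q : X → X → ℝ, transportCost ρ (fun a b => q b a) = transportCost ρ q := fun q => by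
    unfold transportCost
    rw [sum_comm]
    exact sum_congr rfl fun a _ => sum_congr rfl fun b _ => by rw [hρs]
  have hs : ∀ μ ν : X → ℝ,
      transportCost ρ '' couplings ν μ ⊆ transportCost ρ '' couplings μ ν := by
    rintro μ ν _ ⟨q, hq, rfl⟩
    exact ⟨fun a b => q b a, IsCoupling.transpose hq, hc q⟩
  unfold transportDist
  rw [(hs μ ν).antisymm (hs ν μ)]

/-- `ρ_K(μ,μ) = 0` for `ρ ≥ 0` vanishing on the diagonal and `μ ≥ 0` (the diagonal coupling).
[cite: LevinPeres2017, §14.1 Lemma 14.3 ("the other two conditions")] -/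
theorem transportDist_self {ρ : X → X → ℝ} (hρ : ∀ a b, 0 ≤ ρ a b)
    (hρ0 : ∀ a, ρ a a = 0) {μ : X → ℝ} (hμ : ∀ a, 0 ≤ μ a) : transportDist ρ μ μ = 0 := by
  classical
  refine le_antisymm ?_ (transportDist_nonneg hρ μ μ)
  have hq : IsCoupling μ μ (fun a b => if a = b then μ a else 0) := by
    refine ⟨fun a b => ?_, fun a => ?_, fun b => ?_⟩
    · dsimp only
      split_ifs
      · exact hμ a
      · exact le_rfl
    · rw [sum_ite_eq univ a, if_pos (mem_univ a)]
    · simp_rw [@eq_comm _ _ b]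
      rw [sum_ite_eq univ b, if_pos (mem_univ b)]
  refine (transportDist_le hq).trans (le_of_eq ?_)
  unfold transportCost
  refine sum_eq_zero fun a _ => sum_eq_zero fun b _ => ?_
  dsimp only
  split_ifs with h
  · rw [h, hρ0, zero_mul]
  · rw [mul_zero]

omit [Fintype X] in
/-- `δ_x ≥ 0`. [folklore] -/
private theorem single_one_nonneg [DecidableEq X] (x a : X) : 0 ≤ (Pi.single x 1 : X → ℝ) a := by
  rw [Pi.single_apply]; split_ifs <;> norm_num

/-- `Σ δ_x = 1`. [folklore] -/
private theorem sum_single_one [DecidableEq X] (x : X) : ∑ a, (Pi.single x 1 : X → ℝ) a = 1 := by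
  rw [sum_eq_single x (fun a _ ha => Pi.single_eq_of_ne ha _) (fun h => (h (mem_univ x)).elim),
    Pi.single_eq_same]

/-- "`ρ_K` extends the metric `ρ`": **`ρ_K(δ_x,δ_y) = ρ(x,y)`** (the only coupling of two point masses
is the point mass at `(x,y)`). [cite: LevinPeres2017, §14.1 (paragraph after the proof of
Lemma 14.3)] -/
theorem transportDist_single_single [DecidableEq X] (ρ : X → X → ℝ) (x y : X) :
    transportDist ρ (Pi.single x 1) (Pi.single y 1) = ρ x y := by
  have key : ∀ q, IsCoupling (Pi.single x 1 : X → ℝ) (Pi.single y 1) q →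
      transportCost ρ q = ρ x y := by
    intro q hq
    have hab : ∀ a b, ¬(a = x ∧ b = y) → q a b = 0 := by
      intro a b h
      rcases not_and_or.1 h with ha | hb
      · exact hq.apply_eq_zero_of_left (Pi.single_eq_of_ne ha _) b
      · exact hq.apply_eq_zero_of_right (Pi.single_eq_of_ne hb _) a
    have hxy : q x y = 1 := by
      have h := hq.2.1 x
      rw [Pi.single_eq_same, sum_eq_single y (fun b _ hb => hab x b fun h => hb h.2)
        (fun h => (h (mem_univ y)).elim)] at h
      exact h
    unfold transportCost
    rw [sum_eq_single x (fun a _ ha => sum_eq_zero fun b _ => by rw [hab a b fun h => ha h.1, mul_zero])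
      (fun h => (h (mem_univ x)).elim), sum_eq_single y
      (fun b _ hb => by rw [hab x b fun h => hb h.2, mul_zero]) (fun h => (h (mem_univ y)).elim),
      hxy, mul_one]
  have hq0 : IsCoupling (Pi.single x 1 : X → ℝ) (Pi.single y 1)
      (fun a b => (Pi.single x 1 : X → ℝ) a * (Pi.single y 1 : X → ℝ) b) :=
    isCoupling_mul (single_one_nonneg x) (single_one_nonneg y) (sum_single_one x) (sum_single_one y)
  have hs : transportCost ρ '' couplings (Pi.single x 1 : X → ℝ) (Pi.single y 1) = {ρ x y} := by
    refine Set.eq_singleton_iff_unique_mem.2 ⟨⟨_, hq0, key _ hq0⟩, ?_⟩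
    rintro _ ⟨q, hq, rfl⟩
    exact key q hq
  unfold transportDist
  rw [hs, csInf_singleton]

/-- For the discrete metric `ρ = 1{x ≠ y}`, `Σ ρ q = P{X ≠ Y}`. [cite: LevinPeres2017, §14.1
(sentence after (14.2))] -/
theorem transportCost_indicator [DecidableEq X] (q : X → X → ℝ) :
    transportCost (fun a b => if a = b then (0 : ℝ) else 1) q = ∑ a, ∑ b ∈ univ.erase a, q a b := by
  unfold transportCost
  refine sum_congr rfl fun a _ => ?_
  dsimp only
  rw [← sum_erase_add _ _ (mem_univ a), if_pos rfl, zero_mul, add_zero]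
  exact sum_congr rfl fun b hb => by rw [if_neg (ne_of_mem_erase hb).symm, one_mul]

/-- "By Proposition 4.7, if `ρ(x,y) = 1{x ≠ y}`, then **`ρ_K(μ,ν) = ‖μ − ν‖_TV`**."
[cite: LevinPeres2017, §14.1 (sentence after (14.2)), with §4.2 Prop. 4.7 / eq. (4.8)] -/
theorem transportDist_indicator_eq_tvDist [DecidableEq X] {μ ν : X → ℝ} (hμ : ∀ a, 0 ≤ μ a)
    (hν : ∀ b, 0 ≤ ν b) (hμ1 : ∑ a, μ a = 1) (hν1 : ∑ b, ν b = 1) :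
    transportDist (fun a b => if a = b then (0 : ℝ) else 1) μ ν = tvDist μ ν := by
  rw [LevinPeres2017_eq_4_8 hμ hν hμ1 hν1]
  unfold transportDist
  congr 1
  ext r
  simp only [Set.mem_image, mem_couplings, Set.mem_setOf_eq, transportCost_indicator]

/-- **(14.7)**: for `ρ ≥ 0` with `ρ(x,y) ≥ 1{x ≠ y}` and probability vectors `μ, ν`,
**`‖μ − ν‖_TV ≤ ρ_K(μ,ν)`** ("minimizing over all couplings" in (14.6)). [cite: LevinPeres2017, §14.2
eq. (14.7)] -/
theorem LevinPeres2017_eq_14_7 {ρ : X → X → ℝ} (hρ : ∀ a b, 0 ≤ ρ a b)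
    (hρ1 : ∀ a b, a ≠ b → 1 ≤ ρ a b) {μ ν : X → ℝ} (hμ : ∀ a, 0 ≤ μ a) (hν : ∀ b, 0 ≤ ν b)
    (hμ1 : ∑ a, μ a = 1) (hν1 : ∑ b, ν b = 1) : tvDist μ ν ≤ transportDist ρ μ ν := by
  classical
  exact le_transportDist (couplings_nonempty hμ hν hμ1 hν1) fun _ hq =>
    (LevinPeres2017_prop_4_7_le hq).trans (hq.offDiag_le_transportCost hρ hρ1)

/-- `ρ_K(μ,ν) = 0 ⇒ μ = ν` for such `ρ` ("the other two conditions"). [cite: LevinPeres2017, §14.1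
Lemma 14.3 with §14.2 eq. (14.7)] -/
theorem eq_of_transportDist_eq_zero {ρ : X → X → ℝ} (hρ : ∀ a b, 0 ≤ ρ a b)
    (hρ1 : ∀ a b, a ≠ b → 1 ≤ ρ a b) {μ ν : X → ℝ} (hμ : ∀ a, 0 ≤ μ a) (hν : ∀ b, 0 ≤ ν b)
    (hμ1 : ∑ a, μ a = 1) (hν1 : ∑ b, ν b = 1) (h0 : transportDist ρ μ ν = 0) : μ = ν :=
  (tvDist_eq_zero_iff μ ν).1 (le_antisymm (h0 ▸ LevinPeres2017_eq_14_7 hρ hρ1 hμ hν hμ1 hν1)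
    (tvDist_nonneg μ ν))

end Metric

/-! ## The coupling `θ = Σ η(x,y) θ_{x,y}` of `μP` with `νP` and the all-pairs contraction (14.1) -/

section Mix

omit [DecidableEq X]

/-- `θ := Σ_{x,y} η(x,y) θ_{x,y}`: first draw `(x,y) ∼ η`, then `(u,w) ∼ θ_{x,y}`.
[cite: LevinPeres2017, §14.2 proof of Thm 14.6 (p. 205, "Consider the probability distribution
`θ := Σ_{x,y∈X} η(x,y)θ_{x,y}` on `X × X`")] -/
def mixCoupling (η : X → X → ℝ) (θ : X → X → X → X → ℝ) : X → X → ℝ :=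
  fun u w => ∑ x, ∑ y, η x y * θ x y u w

/-- "(This is a coupling of `μP` with `νP`.)" — when `η` couples `μ, ν` and each `θ_{x,y}` couples
`P(x,·)` with `P(y,·)`. [cite: LevinPeres2017, §14.2 proof of Thm 14.6 (p. 205)] -/
theorem mixCoupling_isCoupling {P : X → X → ℝ} {μ ν : X → ℝ} {η : X → X → ℝ} (hη : IsCoupling μ ν η)
    {θ : X → X → X → X → ℝ} (hθ : ∀ x y, IsCoupling (P x) (P y) (θ x y)) :
    IsCoupling (stepLaw P μ) (stepLaw P ν) (mixCoupling η θ) := by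
  refine ⟨fun u w => sum_nonneg fun x _ => sum_nonneg fun y _ =>
    mul_nonneg (hη.1 x y) ((hθ x y).1 u w), fun u => ?_, fun w => ?_⟩
  · unfold mixCoupling stepLaw
    calc ∑ w, ∑ x, ∑ y, η x y * θ x y u w = ∑ x, ∑ y, η x y * ∑ w, θ x y u w := by
          rw [sum_comm]
          refine sum_congr rfl fun x _ => ?_
          rw [sum_comm]
          exact sum_congr rfl fun y _ => by rw [mul_sum]
      _ = ∑ x, ∑ y, η x y * P x u :=
          sum_congr rfl fun x _ => sum_congr rfl fun y _ => by rw [(hθ x y).2.1 u]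
      _ = ∑ x, μ x * P x u := sum_congr rfl fun x _ => by rw [← sum_mul, hη.2.1 x]
  · unfold mixCoupling stepLaw
    calc ∑ u, ∑ x, ∑ y, η x y * θ x y u w = ∑ x, ∑ y, η x y * ∑ u, θ x y u w := by
          rw [sum_comm]
          refine sum_congr rfl fun x _ => ?_
          rw [sum_comm]
          exact sum_congr rfl fun y _ => by rw [mul_sum]
      _ = ∑ x, ∑ y, η x y * P y w :=
          sum_congr rfl fun x _ => sum_congr rfl fun y _ => by rw [(hθ x y).2.2 w]
      _ = ∑ y, ∑ x, η x y * P y w := sum_comm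
      _ = ∑ y, ν y * P y w := sum_congr rfl fun y _ => by rw [← sum_mul, hη.2.2 y]

/-- `Σ_{u,w} ρ(u,w)θ(u,w) = Σ_{x,y} η(x,y) Σ_{u,w} ρ(u,w)θ_{x,y}(u,w)`. [cite: LevinPeres2017, §14.2
proof of Thm 14.6 (p. 205, first line of the last display)] -/
theorem transportCost_mixCoupling (ρ : X → X → ℝ) (η : X → X → ℝ) (θ : X → X → X → X → ℝ) :
    transportCost ρ (mixCoupling η θ) = ∑ x, ∑ y, η x y * transportCost ρ (θ x y) := by
  unfold transportCost mixCoupling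
  calc ∑ u, ∑ w, ρ u w * ∑ x, ∑ y, η x y * θ x y u w
      = ∑ u, ∑ w, ∑ x, ∑ y, η x y * (ρ u w * θ x y u w) := by
        refine sum_congr rfl fun u _ => sum_congr rfl fun w _ => ?_
        rw [mul_sum]
        refine sum_congr rfl fun x _ => ?_
        rw [mul_sum]
        exact sum_congr rfl fun y _ => by ring
    _ = ∑ u, ∑ x, ∑ w, ∑ y, η x y * (ρ u w * θ x y u w) := sum_congr rfl fun u _ => sum_comm
    _ = ∑ x, ∑ u, ∑ w, ∑ y, η x y * (ρ u w * θ x y u w) := sum_comm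
    _ = ∑ x, ∑ y, ∑ u, ∑ w, η x y * (ρ u w * θ x y u w) := by
        refine sum_congr rfl fun x _ => ?_
        calc ∑ u, ∑ w, ∑ y, η x y * (ρ u w * θ x y u w)
            = ∑ u, ∑ y, ∑ w, η x y * (ρ u w * θ x y u w) := sum_congr rfl fun u _ => sum_comm
          _ = ∑ y, ∑ u, ∑ w, η x y * (ρ u w * θ x y u w) := sum_comm
    _ = ∑ x, ∑ y, η x y * ∑ u, ∑ w, ρ u w * θ x y u w := by
        refine sum_congr rfl fun x _ => sum_congr rfl fun y _ => ?_
        rw [mul_sum]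
        exact sum_congr rfl fun u _ => by rw [mul_sum]

/-- The all-pairs contraction **(14.1)** / **(14.16)** propagates to laws: if for every `x, y` there
is a coupling `θ_{x,y}` of `P(x,·), P(y,·)` with `Σ ρ θ_{x,y} ≤ e^{−α}ρ(x,y)`, then for every pair of
laws `μ, ν` admitting a coupling, **`ρ_K(μP,νP) ≤ e^{−α}ρ_K(μ,ν)`** — the last paragraph of the proof
of Theorem 14.6 (which uses only (14.16), not the path structure). [cite: LevinPeres2017, §14.2 proof
of Thm 14.6, eqs. (14.15)–(14.16) and the display on p. 205] -/
theorem transportDist_stepLaw_le_of_forall {P : X → X → ℝ} {ρ : X → X → ℝ} {c : ℝ}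
    (hall : ∀ x y, ∃ θ, IsCoupling (P x) (P y) θ ∧ transportCost ρ θ ≤ c * ρ x y) {μ ν : X → ℝ}
    (hne : (couplings μ ν).Nonempty) :
    transportDist ρ (stepLaw P μ) (stepLaw P ν) ≤ c * transportDist ρ μ ν := by
  choose θ hθ hθc using hall
  -- `η` a `ρ`-optimal coupling of `μ` and `ν` (14.15)
  obtain ⟨η, hη, hηe, -⟩ := LevinPeres2017_rem_14_2 ρ hne
  calc transportDist ρ (stepLaw P μ) (stepLaw P ν)
      ≤ transportCost ρ (mixCoupling η θ) := transportDist_le (mixCoupling_isCoupling hη hθ)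
    _ = ∑ x, ∑ y, η x y * transportCost ρ (θ x y) := transportCost_mixCoupling ρ η θ
    _ ≤ ∑ x, ∑ y, η x y * (c * ρ x y) :=
        sum_le_sum fun x _ => sum_le_sum fun y _ => mul_le_mul_of_nonneg_left (hθc x y) (hη.1 x y)
    _ = c * transportCost ρ η := by
        unfold transportCost
        rw [mul_sum]
        refine sum_congr rfl fun x _ => ?_
        rw [mul_sum]
        exact sum_congr rfl fun y _ => by ring
    _ = c * transportDist ρ μ ν := by rw [hηe]

end Mix

/-! ## Theorem 14.6 (Bubley–Dyer): contraction on edges suffices -/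

section PathCoupling

omit [DecidableEq X]

/-- A path `x = x₀, x₁, …, x_r = y` in the graph with edge relation `E`, of total `ℓ`-length
`L = Σ_{i=1}^r ℓ(x_{i−1},x_i)`. [cite: LevinPeres2017, §14.2 (definition of the length of a path,
before (14.5))] -/
inductive IsGraphPath (E : X → X → Prop) (ℓ : X → X → ℝ) : X → X → ℝ → Prop
  | nil (x : X) : IsGraphPath E ℓ x x 0
  | cons {x y z : X} {L : ℝ} : E x y → IsGraphPath E ℓ y z L → IsGraphPath E ℓ x z (ℓ x y + L)

/-- **(14.12)–(14.14)**: under the triangle inequality for `ρ ≥ 0`, if every pair is joined by an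
edge path of `ρ`-length `≤ ρ(x,y)` (a minimising path of the path metric (14.5)) and each EDGE admits
a coupling with `E ρ(X₁,Y₁) ≤ e^{−α}ρ(x,y)` (14.8), then for ARBITRARY `x, y`,
**`ρ_K(P(x,·),P(y,·)) ≤ e^{−α}ρ(x,y)`** — "by the triangle inequality for `ρ_K`" along the path.
Here `e^{−α}` is any constant `c ≥ 0`. [cite: LevinPeres2017, §14.2 proof of Thm 14.6,
eqs. (14.12)–(14.14)] -/
theorem LevinPeres2017_eq_14_12 {P : X → X → ℝ} (hP : IsRowStochastic P) {ρ : X → X → ℝ}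
    (hρ : ∀ a b, 0 ≤ ρ a b) (hρ0 : ∀ a, ρ a a = 0) (hρt : ∀ x y z, ρ x z ≤ ρ x y + ρ y z)
    {E : X → X → Prop} {c : ℝ}
    (hc : 0 ≤ c) (hedge : ∀ x y, E x y → ∃ θ, IsCoupling (P x) (P y) θ ∧ transportCost ρ θ ≤ c * ρ x y)
    (hpath : ∀ x y, ∃ L, IsGraphPath E ρ x y L ∧ L ≤ ρ x y) (x y : X) :
    transportDist ρ (P x) (P y) ≤ c * ρ x y := by
  have hne : ∀ a b, (couplings (P a) (P b)).Nonempty := fun a b =>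
    couplings_nonempty (hP.1 a) (hP.1 b) (hP.2 a) (hP.2 b)
  -- (14.13)–(14.14) along a path, by induction on the path
  have key : ∀ {a b : X} {L : ℝ}, IsGraphPath E ρ a b L → transportDist ρ (P a) (P b) ≤ c * L := by
    intro a b L h
    induction h with
    | nil a => rw [mul_zero, transportDist_self hρ hρ0 (hP.1 a)]
    | @cons a m b L hE _ ih =>
        obtain ⟨θ, hθ, hθc⟩ := hedge a m hE
        calc transportDist ρ (P a) (P b)
            ≤ transportDist ρ (P a) (P m) + transportDist ρ (P m) (P b) :=
              LevinPeres2017_lemma_14_3 hρt (hne a m) (hne m b)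
          _ ≤ c * ρ a m + c * L := add_le_add ((transportDist_le hθ).trans hθc) ih
          _ = c * (ρ a m + L) := by ring
  obtain ⟨L, hL, hLle⟩ := hpath x y
  exact (key hL).trans (mul_le_mul_of_nonneg_left hLle hc)

/-- **THEOREM 14.6 (Bubley and Dyer 1997).** With `ρ`, `E`, `c = e^{−α}` as in
`LevinPeres2017_eq_14_12` (triangle inequality; every pair joined by an edge path of `ρ`-length
`≤ ρ(x,y)`; contraction (14.8) on EDGES), for any two probability vectors `μ` and `ν`,
**`ρ_K(μP,νP) ≤ e^{−α}ρ_K(μ,ν)`** (14.9). [cite: LevinPeres2017, §14.2 Thm 14.6, eqs. (14.8)–(14.9)] -/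
theorem LevinPeres2017_thm_14_6 {P : X → X → ℝ} (hP : IsRowStochastic P) {ρ : X → X → ℝ}
    (hρ : ∀ a b, 0 ≤ ρ a b) (hρ0 : ∀ a, ρ a a = 0) (hρt : ∀ x y z, ρ x z ≤ ρ x y + ρ y z)
    {E : X → X → Prop} {c : ℝ}
    (hc : 0 ≤ c) (hedge : ∀ x y, E x y → ∃ θ, IsCoupling (P x) (P y) θ ∧ transportCost ρ θ ≤ c * ρ x y)
    (hpath : ∀ x y, ∃ L, IsGraphPath E ρ x y L ∧ L ≤ ρ x y) {μ ν : X → ℝ} (hμ : ∀ a, 0 ≤ μ a)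
    (hν : ∀ b, 0 ≤ ν b) (hμ1 : ∑ a, μ a = 1) (hν1 : ∑ b, ν b = 1) :
    transportDist ρ (stepLaw P μ) (stepLaw P ν) ≤ c * transportDist ρ μ ν := by
  refine transportDist_stepLaw_le_of_forall (fun x y => ?_) (couplings_nonempty hμ hν hμ1 hν1)
  -- (14.16): a `ρ`-optimal coupling of `P(x,·)`, `P(y,·)` has cost `ρ_K ≤ e^{−α}ρ(x,y)` by (14.12)
  obtain ⟨θ, hθ, hθe⟩ := exists_optimalCoupling ρ (hP.1 x) (hP.1 y) (hP.2 x) (hP.2 y)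
  exact ⟨θ, hθ, hθe ▸ LevinPeres2017_eq_14_12 hP hρ hρ0 hρt hc hedge hpath x y⟩

end PathCoupling

/-! ## Remark 14.7 and Corollary 14.8: `d(t) ≤ e^{−αt} diam(X)` and the mixing time -/

section Consequences

/-- `diam(X) = max_{x,y} ρ(x,y)` (as `⨆` over the finite `X × X`; `0` if `X` is empty).
[cite: LevinPeres2017, Ch. 14 opening paragraph (definition of `diam(X)`)] -/
noncomputable def rhoDiam (ρ : X → X → ℝ) : ℝ := ⨆ p : X × X, ρ p.1 p.2

omit [DecidableEq X] in
/-- `ρ(x,y) ≤ diam(X)`. [cite: LevinPeres2017, Ch. 14 opening paragraph (definition of `diam(X)` as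
the maximum)] -/
theorem le_rhoDiam (ρ : X → X → ℝ) (x y : X) : ρ x y ≤ rhoDiam ρ :=
  le_ciSup (f := fun p : X × X => ρ p.1 p.2) (Set.finite_range _).bddAbove (x, y)

omit [DecidableEq X] in
/-- **(14.10)**: a one-step contraction `ρ_K(μP,νP) ≤ c·ρ_K(μ,ν)` for all probability vectors iterates
to `ρ_K(μPᵗ,νPᵗ) ≤ cᵗ ρ_K(μ,ν)`. [cite: LevinPeres2017, §14.2 proof of Cor. 14.8, eq. (14.10)
("By iterating (14.9)")] -/
theorem transportDist_lawAt_le {P : X → X → ℝ} (hP : IsRowStochastic P) {ρ : X → X → ℝ} {c : ℝ}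
    (hc : 0 ≤ c)
    (hstep : ∀ μ ν : X → ℝ, (∀ a, 0 ≤ μ a) → (∀ b, 0 ≤ ν b) → ∑ a, μ a = 1 → ∑ b, ν b = 1 →
      transportDist ρ (stepLaw P μ) (stepLaw P ν) ≤ c * transportDist ρ μ ν)
    {μ ν : X → ℝ} (hμ : ∀ a, 0 ≤ μ a) (hν : ∀ b, 0 ≤ ν b) (hμ1 : ∑ a, μ a = 1) (hν1 : ∑ b, ν b = 1)
    (t : ℕ) : transportDist ρ (lawAt P μ t) (lawAt P ν t) ≤ c ^ t * transportDist ρ μ ν := by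
  induction t with
  | zero => rw [pow_zero, one_mul]; exact le_rfl
  | succ t ih =>
      rw [lawAt_succ, lawAt_succ, pow_succ, mul_comm (c ^ t) c, mul_assoc]
      refine (hstep _ _ (lawAt_nonneg hP hμ t) (lawAt_nonneg hP hν t)
        (by rw [sum_lawAt hP, hμ1]) (by rw [sum_lawAt hP, hν1])).trans ?_
      exact mul_le_mul_of_nonneg_left ih hc

omit [DecidableEq X] in
/-- **REMARK 14.7**: a contraction `ρ_K(μP,νP) ≤ c·ρ_K(μ,ν)` with `c < 1` (for a `ρ ≥ 0` with
`ρ(x,y) ≥ 1{x ≠ y}`) forces the stationary distribution to be UNIQUE: two stationary probability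
vectors coincide ("the assumption that `P` is irreducible is not required").
[cite: LevinPeres2017, §14.2 Remark 14.7] -/
theorem LevinPeres2017_rem_14_7 {P : X → X → ℝ} {ρ : X → X → ℝ} (hρ : ∀ a b, 0 ≤ ρ a b)
    (hρ1 : ∀ a b, a ≠ b → 1 ≤ ρ a b) {c : ℝ} (hc1 : c < 1)
    (hstep : ∀ μ ν : X → ℝ, (∀ a, 0 ≤ μ a) → (∀ b, 0 ≤ ν b) → ∑ a, μ a = 1 → ∑ b, ν b = 1 →
      transportDist ρ (stepLaw P μ) (stepLaw P ν) ≤ c * transportDist ρ μ ν)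
    {π π' : X → ℝ} (hπ : ∀ a, 0 ≤ π a) (hπ1 : ∑ a, π a = 1) (hπP : IsStationary π P)
    (hπ' : ∀ a, 0 ≤ π' a) (hπ'1 : ∑ a, π' a = 1) (hπ'P : IsStationary π' P) : π = π' := by
  have h := hstep π π' hπ hπ' hπ1 hπ'1
  rw [stepLaw_eq_self_of_isStationary hπP, stepLaw_eq_self_of_isStationary hπ'P] at h
  have h0 : transportDist ρ π π' = 0 :=
    le_antisymm (by nlinarith [transportDist_nonneg hρ π π']) (transportDist_nonneg hρ π π')
  exact eq_of_transportDist_eq_zero hρ hρ1 hπ hπ' hπ1 hπ'1 h0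

/-- **(14.11)** / the chapter-opening bound: a one-step contraction of `ρ_K` by `c ≥ 0` (for `ρ ≥ 0`
with `ρ(x,y) ≥ 1{x ≠ y}`) gives **`d(t) ≤ cᵗ · diam(X)`** for the chain with stationary probability
vector `π` ("Applying (14.7) and setting `μ = δ_x` and `ν = π`"). [cite: LevinPeres2017, §14.2
proof of Cor. 14.8, eq. (14.11); Ch. 14 opening paragraph (the display "`‖Pᵗ(x,·) − Pᵗ(y,·)‖_TV ≤ …
≤ diam(X)e^{−αt}`")] -/
theorem worstTvDist_le_of_contraction {P : X → X → ℝ} (hP : IsRowStochastic P) {ρ : X → X → ℝ}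
    (hρ : ∀ a b, 0 ≤ ρ a b) (hρ1 : ∀ a b, a ≠ b → 1 ≤ ρ a b) {c : ℝ} (hc : 0 ≤ c)
    (hstep : ∀ μ ν : X → ℝ, (∀ a, 0 ≤ μ a) → (∀ b, 0 ≤ ν b) → ∑ a, μ a = 1 → ∑ b, ν b = 1 →
      transportDist ρ (stepLaw P μ) (stepLaw P ν) ≤ c * transportDist ρ μ ν)
    {π : X → ℝ} (hπ : ∀ a, 0 ≤ π a) (hπ1 : ∑ a, π a = 1) (hπP : IsStationary π P) (t : ℕ) :
    worstTvDist P π t ≤ c ^ t * rhoDiam ρ := by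
  cases isEmpty_or_nonempty X with
  | inl h =>
      have : worstTvDist P π t = 0 := Real.iSup_of_isEmpty _
      have hd : rhoDiam ρ = 0 := Real.iSup_of_isEmpty _
      rw [this, hd, mul_zero]
  | inr h =>
      refine ciSup_le fun x => ?_
      have hx : ∀ a, 0 ≤ (Pi.single x 1 : X → ℝ) a := single_one_nonneg x
      have hx1 : ∑ a, (Pi.single x 1 : X → ℝ) a = 1 := sum_single_one x
      calc tvDist (lawAt P (Pi.single x 1) t) π
          = tvDist (lawAt P (Pi.single x 1) t) (lawAt P π t) := by
            rw [lawAt_eq_self_of_isStationary hπP]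
        _ ≤ transportDist ρ (lawAt P (Pi.single x 1) t) (lawAt P π t) :=
            LevinPeres2017_eq_14_7 hρ hρ1 (lawAt_nonneg hP hx t) (lawAt_nonneg hP hπ t)
              (by rw [sum_lawAt hP, hx1]) (by rw [sum_lawAt hP, hπ1])
        _ ≤ c ^ t * transportDist ρ (Pi.single x 1) π :=
            transportDist_lawAt_le hP hc hstep hx hπ hx1 hπ1 t
        _ ≤ c ^ t * rhoDiam ρ :=
            mul_le_mul_of_nonneg_left (transportDist_le_of_le hx hπ hx1 hπ1 (le_rhoDiam ρ)) (pow_nonneg hc t)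

/-- The arithmetic of Corollary 14.8: `e^{−αn}·D ≤ ε` once `n ≥ (−log ε + log D)/α` (`α, ε > 0`).
[cite: LevinPeres2017, §14.2 Cor. 14.8 (the passage from `d(t) ≤ e^{−αt}diam(X)` to the bound on
`t_mix(ε)`)] -/
theorem exp_neg_pow_mul_le {α ε D : ℝ} {n : ℕ} (hα : 0 < α) (hε : 0 < ε)
    (hn : (-Real.log ε + Real.log D) / α ≤ n) : Real.exp (-α) ^ n * D ≤ ε := by
  rw [← Real.exp_nat_mul]
  rcases le_or_gt D 0 with hD | hD
  · nlinarith [Real.exp_pos ((n : ℝ) * -α)]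
  · have h1 : (n : ℝ) * -α ≤ Real.log ε - Real.log D := by
      rw [div_le_iff₀ hα] at hn; nlinarith
    calc Real.exp (n * -α) * D ≤ Real.exp (Real.log ε - Real.log D) * D :=
          mul_le_mul_of_nonneg_right (Real.exp_le_exp.2 h1) hD.le
      _ = ε := by rw [Real.exp_sub, Real.exp_log hε, Real.exp_log hD, div_mul_cancel₀ _ hD.ne']

/-- The mixing-time consequence of a one-step `ρ_K`-contraction by `e^{−α}`, `α > 0` (for `ρ ≥ 0`
with `ρ(x,y) ≥ 1{x ≠ y}`, stationary probability vector `π`):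
**`t_mix(ε) ≤ ⌈(−log ε + log diam(X))/α⌉`** (`= ⌈α⁻¹[log(diam(X)) + log(1/ε)]⌉`, the chapter-opening
display). [cite: LevinPeres2017, §14.2 Cor. 14.8; Ch. 14 opening paragraph (the display
"`t_mix(ε) ≤ ⌈α⁻¹[log(diam(X)) + log(1/ε)]⌉`")] -/
theorem mixingTime_le_of_contraction {P : X → X → ℝ} (hP : IsRowStochastic P)
    {ρ : X → X → ℝ} (hρ : ∀ a b, 0 ≤ ρ a b) (hρ1 : ∀ a b, a ≠ b → 1 ≤ ρ a b) {α : ℝ} (hα : 0 < α)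
    (hstep : ∀ μ ν : X → ℝ, (∀ a, 0 ≤ μ a) → (∀ b, 0 ≤ ν b) → ∑ a, μ a = 1 → ∑ b, ν b = 1 →
      transportDist ρ (stepLaw P μ) (stepLaw P ν) ≤ Real.exp (-α) * transportDist ρ μ ν)
    {π : X → ℝ} (hπ : ∀ a, 0 ≤ π a) (hπ1 : ∑ a, π a = 1) (hπP : IsStationary π P) {ε : ℝ}
    (hε : 0 < ε) : mixingTime P π ε ≤ ⌈(-Real.log ε + Real.log (rhoDiam ρ)) / α⌉₊ :=
  mixingTime_le P π
    ((worstTvDist_le_of_contraction hP hρ hρ1 (Real.exp_pos _).le hstep hπ hπ1 hπP _).trans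
      (exp_neg_pow_mul_le hα hε (Nat.le_ceil _)))

/-- The same bound written as in the chapter opening, `⌈(log diam(X) + log(1/ε))/α⌉`.
[cite: LevinPeres2017, Ch. 14 opening paragraph] -/
theorem mixingTime_le_of_contraction' {P : X → X → ℝ} (hP : IsRowStochastic P)
    {ρ : X → X → ℝ} (hρ : ∀ a b, 0 ≤ ρ a b) (hρ1 : ∀ a b, a ≠ b → 1 ≤ ρ a b) {α : ℝ} (hα : 0 < α)
    (hstep : ∀ μ ν : X → ℝ, (∀ a, 0 ≤ μ a) → (∀ b, 0 ≤ ν b) → ∑ a, μ a = 1 → ∑ b, ν b = 1 →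
      transportDist ρ (stepLaw P μ) (stepLaw P ν) ≤ Real.exp (-α) * transportDist ρ μ ν)
    {π : X → ℝ} (hπ : ∀ a, 0 ≤ π a) (hπ1 : ∑ a, π a = 1) (hπP : IsStationary π P) {ε : ℝ}
    (hε : 0 < ε) : mixingTime P π ε ≤ ⌈(Real.log (rhoDiam ρ) + Real.log (1 / ε)) / α⌉₊ := by
  rw [one_div, Real.log_inv, add_comm (Real.log (rhoDiam ρ))]
  exact mixingTime_le_of_contraction hP hρ hρ1 hα hstep hπ hπ1 hπP hε

/-- **COROLLARY 14.8 (first part).** Under the hypotheses of Theorem 14.6 (with `c = e^{−α} ≥ 0` and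
`ρ(x,y) ≥ 1{x ≠ y}`, which holds for a path metric with edge lengths `≥ 1`), and `π` a stationary
probability vector, **`d(t) ≤ e^{−αt} diam(X)`** (here `cᵗ·diam`). [cite: LevinPeres2017, §14.2
Cor. 14.8, eqs. (14.10)–(14.11)] -/
theorem LevinPeres2017_cor_14_8 {P : X → X → ℝ} (hP : IsRowStochastic P) {ρ : X → X → ℝ}
    (hρ : ∀ a b, 0 ≤ ρ a b) (hρ0 : ∀ a, ρ a a = 0) (hρ1 : ∀ a b, a ≠ b → 1 ≤ ρ a b)
    (hρt : ∀ x y z, ρ x z ≤ ρ x y + ρ y z) {E : X → X → Prop} {c : ℝ} (hc : 0 ≤ c)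
    (hedge : ∀ x y, E x y → ∃ θ, IsCoupling (P x) (P y) θ ∧ transportCost ρ θ ≤ c * ρ x y)
    (hpath : ∀ x y, ∃ L, IsGraphPath E ρ x y L ∧ L ≤ ρ x y) {π : X → ℝ} (hπ : ∀ a, 0 ≤ π a)
    (hπ1 : ∑ a, π a = 1) (hπP : IsStationary π P) (t : ℕ) : worstTvDist P π t ≤ c ^ t * rhoDiam ρ :=
  worstTvDist_le_of_contraction hP hρ hρ1 hc
    (fun _ _ hμ hν hμ1 hν1 => LevinPeres2017_thm_14_6 hP hρ hρ0 hρt hc hedge hpath hμ hν hμ1 hν1)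
    hπ hπ1 hπP t

/-- **COROLLARY 14.8 (second part).** Under the hypotheses of Theorem 14.6 with `α > 0`,
**`t_mix(ε) ≤ ⌈(−log ε + log diam(X))/α⌉`** for every `0 < ε`. [cite: LevinPeres2017, §14.2
Cor. 14.8] -/
theorem LevinPeres2017_cor_14_8_mixingTime {P : X → X → ℝ} (hP : IsRowStochastic P)
    {ρ : X → X → ℝ} (hρ : ∀ a b, 0 ≤ ρ a b) (hρ0 : ∀ a, ρ a a = 0) (hρ1 : ∀ a b, a ≠ b → 1 ≤ ρ a b)
    (hρt : ∀ x y z, ρ x z ≤ ρ x y + ρ y z) {E : X → X → Prop} {α : ℝ} (hα : 0 < α)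
    (hedge : ∀ x y, E x y → ∃ θ, IsCoupling (P x) (P y) θ ∧ transportCost ρ θ ≤ Real.exp (-α) * ρ x y)
    (hpath : ∀ x y, ∃ L, IsGraphPath E ρ x y L ∧ L ≤ ρ x y) {π : X → ℝ} (hπ : ∀ a, 0 ≤ π a)
    (hπ1 : ∑ a, π a = 1) (hπP : IsStationary π P) {ε : ℝ} (hε : 0 < ε) :
    mixingTime P π ε ≤ ⌈(-Real.log ε + Real.log (rhoDiam ρ)) / α⌉₊ :=
  mixingTime_le_of_contraction hP hρ hρ1 hα
    (fun _ _ hμ hν hμ1 hν1 => LevinPeres2017_thm_14_6 hP hρ hρ0 hρt (Real.exp_pos _).le hedge hpath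
      hμ hν hμ1 hν1) hπ hπ1 hπP hε

/-- The all-pairs version (chapter opening): if EVERY pair `x, y` admits a coupling of
`P(x,·), P(y,·)` with `E ρ(X₁,Y₁) ≤ e^{−α}ρ(x,y)` **(14.1)** (`ρ ≥ 0`, `ρ(x,y) ≥ 1{x ≠ y}`, no path
structure or triangle inequality needed), then `d(t) ≤ e^{−αt}diam(X)`.
[cite: LevinPeres2017, Ch. 14 opening paragraph, eq. (14.1) and the following displays] -/
theorem LevinPeres2017_eq_14_1_worstTvDist {P : X → X → ℝ} (hP : IsRowStochastic P)
    {ρ : X → X → ℝ} (hρ : ∀ a b, 0 ≤ ρ a b) (hρ1 : ∀ a b, a ≠ b → 1 ≤ ρ a b) {c : ℝ} (hc : 0 ≤ c)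
    (hall : ∀ x y, ∃ θ, IsCoupling (P x) (P y) θ ∧ transportCost ρ θ ≤ c * ρ x y) {π : X → ℝ}
    (hπ : ∀ a, 0 ≤ π a) (hπ1 : ∑ a, π a = 1) (hπP : IsStationary π P) (t : ℕ) :
    worstTvDist P π t ≤ c ^ t * rhoDiam ρ :=
  worstTvDist_le_of_contraction hP hρ hρ1 hc
    (fun _ _ hμ hν hμ1 hν1 => transportDist_stepLaw_le_of_forall hall (couplings_nonempty hμ hν hμ1 hν1))
    hπ hπ1 hπP t

end Consequences

end Literature.Probability.MarkovChains
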